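/-
rh-inputs cell (A1 = `Grosswald1967_thmB`), prover-3, 2026-08-28.  Chain combinatorics for the
Laguerre–Fejér rule of signs (`PolyaSignChangesLaguerre.lean`): the breakpoint lemma.
Self-contained real analysis; nothing in this file bears on the truth of RH.
-/
import Mathlib.Analysis.SpecialFunctions.Log.Basic
import Mathlib.Data.Fin.Tuple.Basic
import Mathlib.Order.Fin.Basic
import Mathlib.Order.ConditionallyCompleteLattice.Basic
import HarnessLib

/-!
# Alternating sign chains: surgery and the breakpoint lemma

Support file for `Literature/NumberTheory/LFunctions/PolyaSignChangesLaguerre.lean` (the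
Laguerre–Fejér rule of signs for truncated Mellin moments, input `stub_laguerre` of the A1
architecture for `Grosswald1967_thmB`).  Everything here is elementary real-variable combinatorics of
ALTERNATING CHAINS of a function `w : ℝ → ℝ` inside a set `S ⊆ ℝ`, spelled exactly as in
`PolyaSignChanges.HasSignChain` / `Grosswald1967_thmB`: a strictly increasing `x : Fin (n+1) → ℝ`
with values in `S` and `w (x i.castSucc) * w (x i.succ) < 0` for all `i : Fin n` ("length `n`").
"Chain bound `N`" means every chain has length `≤ N` (at most `N` reversals of sign of `w` on `S`,
Pólya–Szegő II, Part V, Chap. 1, §2).  No definitions are introduced (the three chain clauses are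
carried as separate hypotheses).

## Main result

`Laguerre.chainBound_mul_log_sub` (**breakpoint lemma**): if `w` has chain bound `N + 1` on
`S ⊆ (1, ∞)` and a chain of length `N + 1` exists, let `A` be the infimum of the last points of all
chains of length `N + 1` (the position of the LAST reversal of sign) and `c := log A`; then `c > 0`
and the weight `t ↦ w(t) (log t − c)` has chain bound `N` on `S`.  (Beyond `A` the sign of `w` is
frozen to the common last sign of the maximal chains, before `A` the factor `log t − c < 0` flips
it, so the last reversal is cancelled and no new one is created.)  This is the step
`φ*(λ) = (λ₀ − λ) φ(λ)`, `R* = R − 1` of Laguerre's proof (PSz V.80), done for a general weight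
without any piecewise-constancy or continuity assumption — hence the infimum.

## Contents

Public: `chainBound_mul_log_sub` (breakpoint lemma), `chainBound_of_not_exists` (no chain of length
`N + 1` ⇒ chain bound `N`).  Private plumbing: sign bookkeeping (`sgn_pos_pos`, `sgn_pos_neg`,
`sgn_neg_pos`: relative signs carried by products), chain surgery (`snoc_chain`, `prefix_chain`),
maximal chains (`last_sign_pos`, `penult_lt_last`), `breakpoint_noChain` (core of the breakpoint
lemma with `A` abstracted by its two properties).

## References

* G. Pólya, G. Szegő, *Problems and Theorems in Analysis II*, Part V, Chap. 1, §2 and Problem 80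
  (Springer 1976) [PolyaSzego1976]; E. Laguerre, J. Math. Pures Appl. (3) 9 (1883), p. 29 (cited
  through PSz V.80).
-/

noncomputable section

open Set

namespace Literature.NumberTheory.LFunctions

namespace PolyaSignChanges

namespace Laguerre

/-! ### Sign bookkeeping (products of reals as carriers of relative sign) -/

/-- `ab < 0`, `b > 0` ⇒ `a < 0`. [folklore] -/
private theorem neg_of_mul_neg_of_pos {a b : ℝ} (h : a * b < 0) (hb : 0 < b) : a < 0 :=
  (mul_neg_iff.1 h).elim (fun h' => absurd hb (not_lt.2 h'.2.le)) fun h' => h'.1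

/-- `ab < 0`, `b < 0` ⇒ `a > 0`. [folklore] -/
private theorem pos_of_mul_neg_of_neg {a b : ℝ} (h : a * b < 0) (hb : b < 0) : 0 < a :=
  (mul_neg_iff.1 h).elim (fun h' => h'.1) fun h' => absurd hb (not_lt.2 h'.2.le)

/-- `ab > 0`, `a > 0` ⇒ `b > 0`. [folklore] -/
private theorem pos_of_mul_pos_of_pos {a b : ℝ} (h : 0 < a * b) (ha : 0 < a) : 0 < b :=
  (mul_pos_iff.1 h).elim (fun h' => h'.2) fun h' => absurd ha (not_lt.2 h'.1.le)

/-- Relative signs compose: `ab > 0`, `bc > 0` ⇒ `ac > 0`. [folklore] -/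
private theorem sgn_pos_pos {a b c : ℝ} (h1 : 0 < a * b) (h2 : 0 < b * c) : 0 < a * c := by
  have hb : b ≠ 0 := (mul_ne_zero_iff.1 h1.ne').2
  have h : 0 < (b * b) * (a * c) := by
    have := mul_pos h1 h2
    calc (0 : ℝ) < a * b * (b * c) := this
      _ = (b * b) * (a * c) := by ring
  exact pos_of_mul_pos_of_pos h (mul_self_pos.2 hb)

/-- Relative signs compose: `ab > 0`, `bc < 0` ⇒ `ac < 0`. [folklore] -/
private theorem sgn_pos_neg {a b c : ℝ} (h1 : 0 < a * b) (h2 : b * c < 0) : a * c < 0 := by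
  have hb : b ≠ 0 := (mul_ne_zero_iff.1 h1.ne').2
  have h : (a * c) * (b * b) < 0 := by
    have := mul_neg_of_pos_of_neg h1 h2
    calc a * c * (b * b) = a * b * (b * c) := by ring
      _ < 0 := this
  exact neg_of_mul_neg_of_pos h (mul_self_pos.2 hb)

/-- Relative signs compose: `ab < 0`, `bc > 0` ⇒ `ac < 0`. [folklore] -/
private theorem sgn_neg_pos {a b c : ℝ} (h1 : a * b < 0) (h2 : 0 < b * c) : a * c < 0 := by
  have h1' : 0 < c * b := by rw [mul_comm]; exact h2
  have h2' : b * a < 0 := by rw [mul_comm]; exact h1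
  rw [mul_comm]; exact sgn_pos_neg h1' h2'

/-! ### Chain surgery (chains spelled as in `HasSignChain`: `StrictMono`, membership, alternating
consecutive products) -/

/-- Appending a point beyond the last point of an alternating chain, with the opposite sign, gives an
alternating chain one longer. [folklore] -/
private theorem snoc_chain {w : ℝ → ℝ} {S : Set ℝ} {n : ℕ} {x : Fin (n + 1) → ℝ} {t : ℝ}
    (hx : StrictMono x) (hmem : ∀ i, x i ∈ S)
    (hsign : ∀ i : Fin n, w (x i.castSucc) * w (x i.succ) < 0)
    (hlt : x (Fin.last n) < t) (ht : t ∈ S) (hwt : w (x (Fin.last n)) * w t < 0) :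
    StrictMono (Fin.snoc x t : Fin (n + 2) → ℝ) ∧
      (∀ i, (Fin.snoc x t : Fin (n + 2) → ℝ) i ∈ S) ∧
      ∀ i : Fin (n + 1), w ((Fin.snoc x t : Fin (n + 2) → ℝ) i.castSucc) *
        w ((Fin.snoc x t : Fin (n + 2) → ℝ) i.succ) < 0 := by
  refine ⟨?_, ?_, ?_⟩
  · rw [Fin.strictMono_iff_lt_succ]
    intro i
    rcases Fin.eq_castSucc_or_eq_last i with ⟨j, rfl⟩ | rfl
    · rw [Fin.succ_castSucc, Fin.snoc_castSucc, Fin.snoc_castSucc]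
      exact hx j.castSucc_lt_succ
    · rw [Fin.snoc_castSucc, Fin.succ_last, Fin.snoc_last]
      exact hlt
  · intro i
    rcases Fin.eq_castSucc_or_eq_last i with ⟨j, rfl⟩ | rfl
    · rw [Fin.snoc_castSucc]; exact hmem j
    · rw [Fin.snoc_last]; exact ht
  · intro i
    rcases Fin.eq_castSucc_or_eq_last i with ⟨j, rfl⟩ | rfl
    · rw [Fin.succ_castSucc, Fin.snoc_castSucc, Fin.snoc_castSucc]; exact hsign j
    · rw [Fin.snoc_castSucc, Fin.succ_last, Fin.snoc_last]; exact hwt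

/-- The initial segment (first `m + 1` points) of an alternating chain is an alternating chain.
[folklore] -/
private theorem prefix_chain {w : ℝ → ℝ} {S : Set ℝ} {n m : ℕ} {x : Fin (n + 1) → ℝ} (h : m ≤ n)
    (hx : StrictMono x) (hmem : ∀ i, x i ∈ S)
    (hsign : ∀ i : Fin n, w (x i.castSucc) * w (x i.succ) < 0) :
    StrictMono (fun i : Fin (m + 1) => x (Fin.castLE (Nat.succ_le_succ h) i)) ∧
      (∀ i : Fin (m + 1), x (Fin.castLE (Nat.succ_le_succ h) i) ∈ S) ∧
      ∀ i : Fin m, w (x (Fin.castLE (Nat.succ_le_succ h) i.castSucc)) *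
        w (x (Fin.castLE (Nat.succ_le_succ h) i.succ)) < 0 := by
  refine ⟨hx.comp (Fin.strictMono_castLE _), fun i => hmem _, fun i => ?_⟩
  have h1 : Fin.castLE (Nat.succ_le_succ h) i.castSucc = (Fin.castLE h i).castSucc := Fin.ext rfl
  have h2 : Fin.castLE (Nat.succ_le_succ h) i.succ = (Fin.castLE h i).succ := Fin.ext rfl
  rw [h1, h2]
  exact hsign _

/-- Two alternating chains of the maximal length `N + 1` end with the same sign. [folklore] -/
private theorem last_sign_pos {w : ℝ → ℝ} {S : Set ℝ} {N : ℕ}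
    (hN : ∀ (n : ℕ) (x : Fin (n + 1) → ℝ), StrictMono x → (∀ i, x i ∈ S) →
      (∀ i : Fin n, w (x i.castSucc) * w (x i.succ) < 0) → n ≤ N + 1)
    {x x' : Fin (N + 2) → ℝ}
    (hx : StrictMono x) (hxm : ∀ i, x i ∈ S)
    (hxs : ∀ i : Fin (N + 1), w (x i.castSucc) * w (x i.succ) < 0)
    (hx' : StrictMono x') (hx'm : ∀ i, x' i ∈ S)
    (hx's : ∀ i : Fin (N + 1), w (x' i.castSucc) * w (x' i.succ) < 0) :
    0 < w (x (Fin.last (N + 1))) * w (x' (Fin.last (N + 1))) := by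
  have h1 := hxs (Fin.last N)
  have h2 := hx's (Fin.last N)
  rw [Fin.succ_last] at h1 h2
  have hne : w (x (Fin.last (N + 1))) ≠ 0 := (mul_ne_zero_iff.1 h1.ne).2
  have hne' : w (x' (Fin.last (N + 1))) ≠ 0 := (mul_ne_zero_iff.1 h2.ne).2
  rcases (mul_ne_zero hne hne').lt_or_gt with hneg | hpos
  · exfalso
    rcases lt_trichotomy (x (Fin.last (N + 1))) (x' (Fin.last (N + 1))) with hlt | heq | hgt
    · obtain ⟨c1, c2, c3⟩ := snoc_chain hx hxm hxs hlt (hx'm _) hneg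
      have := hN (N + 2) _ c1 c2 c3
      omega
    · rw [heq] at hneg
      exact absurd hneg (not_lt.2 (mul_self_nonneg _))
    · rw [mul_comm] at hneg
      obtain ⟨c1, c2, c3⟩ := snoc_chain hx' hx'm hx's hgt (hxm _) hneg
      have := hN (N + 2) _ c1 c2 c3
      omega
  · exact hpos

/-- For two alternating chains of the maximal length `N + 1`, the penultimate point of one lies
strictly before the last point of the other. [folklore] -/
private theorem penult_lt_last {w : ℝ → ℝ} {S : Set ℝ} {N : ℕ}
    (hN : ∀ (n : ℕ) (x : Fin (n + 1) → ℝ), StrictMono x → (∀ i, x i ∈ S) →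
      (∀ i : Fin n, w (x i.castSucc) * w (x i.succ) < 0) → n ≤ N + 1)
    {x x' : Fin (N + 2) → ℝ}
    (hx : StrictMono x) (hxm : ∀ i, x i ∈ S)
    (hxs : ∀ i : Fin (N + 1), w (x i.castSucc) * w (x i.succ) < 0)
    (hx' : StrictMono x') (hx'm : ∀ i, x' i ∈ S)
    (hx's : ∀ i : Fin (N + 1), w (x' i.castSucc) * w (x' i.succ) < 0) :
    x (Fin.last N).castSucc < x' (Fin.last (N + 1)) := by
  have h1 := hxs (Fin.last N)
  rw [Fin.succ_last] at h1
  have h2 := last_sign_pos hN hx hxm hxs hx' hx'm hx's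
  have h3 : w (x (Fin.last N).castSucc) * w (x' (Fin.last (N + 1))) < 0 := sgn_neg_pos h1 h2
  rcases lt_trichotomy (x (Fin.last N).castSucc) (x' (Fin.last (N + 1))) with h | h | h
  · exact h
  · rw [h] at h3
    exact absurd h3 (not_lt.2 (mul_self_nonneg _))
  · exfalso
    rw [mul_comm] at h3
    obtain ⟨c1, c2, c3⟩ := snoc_chain hx' hx'm hx's h (hxm _) h3
    have := hN (N + 2) _ c1 c2 c3
    omega

/-! ### The breakpoint lemma -/

/-- **Breakpoint lemma, core.**  Let `w` have chain bound `N + 1` on `S ⊆ (1, ∞)` and let `z` be a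
chain of length `N + 1`.  Suppose `A > 0` lies below the last point of every chain of length `N + 1`
and the sign of `w` on `S ∩ (A, ∞)` is frozen to the last sign of `z` (weakly).  Then
`w'(t) = w(t) (log t − log A)` has NO alternating chain of length `N + 1` in `S`. [folklore] -/
private theorem breakpoint_noChain {w : ℝ → ℝ} {S : Set ℝ} (hS : S ⊆ Ioi 1) {N : ℕ}
    (hN : ∀ (n : ℕ) (x : Fin (n + 1) → ℝ), StrictMono x → (∀ i, x i ∈ S) →
      (∀ i : Fin n, w (x i.castSucc) * w (x i.succ) < 0) → n ≤ N + 1)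
    {z : Fin (N + 2) → ℝ} (hz : StrictMono z) (hzm : ∀ i, z i ∈ S)
    (hzs : ∀ i : Fin (N + 1), w (z i.castSucc) * w (z i.succ) < 0)
    {A : ℝ} (hA0 : 0 < A)
    (hAle : ∀ x : Fin (N + 2) → ℝ, StrictMono x → (∀ i, x i ∈ S) →
      (∀ i : Fin (N + 1), w (x i.castSucc) * w (x i.succ) < 0) → A ≤ x (Fin.last (N + 1)))
    (hfrozen : ∀ t ∈ S, A < t → 0 ≤ w (z (Fin.last (N + 1))) * w t)
    {v : Fin (N + 2) → ℝ} (hv : StrictMono v) (hvm : ∀ i, v i ∈ S)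
    (hvs : ∀ i : Fin (N + 1), (w (v i.castSucc) * (Real.log (v i.castSucc) - Real.log A)) *
      (w (v i.succ) * (Real.log (v i.succ) - Real.log A)) < 0) : False := by
  -- positivity of the points and the sign of the factor `log t - log A`
  have hpos : ∀ i, 0 < v i := fun i => lt_trans one_pos (hS (hvm i))
  have hfac_neg : ∀ i, v i < A → Real.log (v i) - Real.log A < 0 := fun i h =>
    sub_neg.2 (Real.log_lt_log (hpos i) h)
  have hfac_pos : ∀ i, A < v i → 0 < Real.log (v i) - Real.log A := fun i h =>
    sub_pos.2 (Real.log_lt_log hA0 h)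
  -- no point of `v` is `A`, and `w` does not vanish on `v`
  have hwv : ∀ i, w (v i) * (Real.log (v i) - Real.log A) ≠ 0 := by
    intro i
    rcases Fin.eq_castSucc_or_eq_last i with ⟨j, rfl⟩ | rfl
    · exact (mul_ne_zero_iff.1 (hvs j).ne).1
    · have := hvs (Fin.last N)
      rw [Fin.succ_last] at this
      exact (mul_ne_zero_iff.1 this.ne).2
  have hvA : ∀ i, v i ≠ A := by
    intro i h
    apply hwv i
    rw [h, sub_self, mul_zero]
  have hw0 : ∀ i, w (v i) ≠ 0 := fun i => (mul_ne_zero_iff.1 (hwv i)).1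
  -- the last step of `z`: `w (z_N) * s < 0` with `s = w (z_{N+1}) ≠ 0`
  have hzlast := hzs (Fin.last N)
  rw [Fin.succ_last] at hzlast
  have hs0 : w (z (Fin.last (N + 1))) ≠ 0 := (mul_ne_zero_iff.1 hzlast.ne).2
  have hfrozen' : ∀ i, A < v i → 0 < w (z (Fin.last (N + 1))) * w (v i) := fun i h =>
    lt_of_le_of_ne (hfrozen _ (hvm i) h) (mul_ne_zero hs0 (hw0 i)).symm
  -- the last `w'`-step of `v`
  have hlast := hvs (Fin.last N)
  rw [Fin.succ_last] at hlast
  have e_last : (w (v (Fin.last N).castSucc) * (Real.log (v (Fin.last N).castSucc) - Real.log A)) *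
      (w (v (Fin.last (N + 1))) * (Real.log (v (Fin.last (N + 1))) - Real.log A)) =
      (w (v (Fin.last N).castSucc) * w (v (Fin.last (N + 1)))) *
        ((Real.log (v (Fin.last N).castSucc) - Real.log A) *
          (Real.log (v (Fin.last (N + 1))) - Real.log A)) := by ring
  rw [e_last] at hlast
  -- Step 1: the penultimate point of `v` lies below `A`
  have hPA : v (Fin.last N).castSucc < A := by
    rcases lt_or_gt_of_ne (hvA (Fin.last N).castSucc) with h | h
    · exact h
    · exfalso
      have hL : A < v (Fin.last (N + 1)) := lt_trans h (hv (Fin.castSucc_lt_last (Fin.last N)))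
      have h1 := hfrozen' _ h
      have h2 := hfrozen' _ hL
      have h3 : 0 < w (v (Fin.last N).castSucc) * w (v (Fin.last (N + 1))) := by
        rw [mul_comm] at h1
        exact sgn_pos_pos h1 h2
      have h4 := mul_pos h3 (mul_pos (hfac_pos _ h) (hfac_pos _ hL))
      exact absurd hlast (not_lt.2 h4.le)
  -- Step 2: all points but possibly the last lie below `A`
  have hcsA : ∀ i : Fin (N + 1), v i.castSucc < A := fun i =>
    lt_of_le_of_lt (hv.monotone (Fin.castSucc_le_castSucc_iff.2 (Fin.le_last i))) hPA
  -- Step 3: below `A` the `w'`-steps are `w`-steps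
  have hwprod : ∀ i : Fin (N + 1), v i.succ < A → w (v i.castSucc) * w (v i.succ) < 0 := by
    intro i hsucc
    have h := hvs i
    have e : (w (v i.castSucc) * (Real.log (v i.castSucc) - Real.log A)) *
        (w (v i.succ) * (Real.log (v i.succ) - Real.log A)) =
        (w (v i.castSucc) * w (v i.succ)) *
          ((Real.log (v i.castSucc) - Real.log A) * (Real.log (v i.succ) - Real.log A)) := by ring
    rw [e] at h
    exact neg_of_mul_neg_of_pos h (mul_pos_of_neg_of_neg (hfac_neg _ (hcsA i)) (hfac_neg _ hsucc))
  -- the initial segment `v ∘ castSucc` is a `w`-chain of length `N`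
  have hu : StrictMono (fun i : Fin (N + 1) => v i.castSucc) := hv.comp Fin.strictMono_castSucc
  have hum : ∀ i : Fin (N + 1), v i.castSucc ∈ S := fun i => hvm _
  have hus : ∀ i : Fin N, w (v i.castSucc.castSucc) * w (v i.succ.castSucc) < 0 := by
    intro i
    have := hwprod i.castSucc (by rw [Fin.succ_castSucc]; exact hcsA i.succ)
    rwa [Fin.succ_castSucc] at this
  -- Step 4: position of the last point of `v`
  rcases lt_or_gt_of_ne (hvA (Fin.last (N + 1))) with hLA | hLA
  · -- every point of `v` lies below `A`: `v` is a `w`-chain of length `N + 1` ending below `A`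
    have hvs' : ∀ i : Fin (N + 1), w (v i.castSucc) * w (v i.succ) < 0 := fun i =>
      hwprod i (lt_of_le_of_lt (hv.monotone (Fin.le_last _)) hLA)
    exact absurd (hAle v hv hvm hvs') (not_le.2 hLA)
  · -- the last point lies beyond `A`
    have h1 : 0 < w (z (Fin.last (N + 1))) * w (v (Fin.last (N + 1))) := hfrozen' _ hLA
    have h2 : 0 < w (v (Fin.last N).castSucc) * w (v (Fin.last (N + 1))) :=
      pos_of_mul_neg_of_neg hlast (mul_neg_of_neg_of_pos (hfac_neg _ hPA) (hfac_pos _ hLA))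
    have h3 : 0 < w (z (Fin.last (N + 1))) * w (v (Fin.last N).castSucc) := by
      rw [mul_comm] at h2
      exact sgn_pos_pos h1 h2
    have h5 : w (z (Fin.last N).castSucc) * w (v (Fin.last N).castSucc) < 0 :=
      sgn_neg_pos hzlast h3
    rcases lt_trichotomy (z (Fin.last N).castSucc) (v (Fin.last N).castSucc) with hlt | heq | hgt
    · -- `z₀ … z_N, v_N` is a chain of length `N + 1` ending below `A`
      have hz1 : StrictMono (fun i : Fin (N + 1) => z i.castSucc) := hz.comp Fin.strictMono_castSucc
      have hz2 : ∀ i : Fin (N + 1), z i.castSucc ∈ S := fun i => hzm _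
      have hz3 : ∀ i : Fin N, w (z i.castSucc.castSucc) * w (z i.succ.castSucc) < 0 := by
        intro i
        have := hzs i.castSucc
        rwa [Fin.succ_castSucc] at this
      obtain ⟨c1, c2, c3⟩ :=
        snoc_chain (w := w) (x := fun i : Fin (N + 1) => z i.castSucc) hz1 hz2 hz3 hlt (hvm _) h5
      have := hAle _ c1 c2 c3
      rw [Fin.snoc_last] at this
      exact absurd this (not_le.2 hPA)
    · rw [heq] at h5
      exact absurd h5 (not_lt.2 (mul_self_nonneg _))
    · -- `v₀ … v_N, z_N` is a chain of length `N + 1` whose last sign is the wrong one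
      rw [mul_comm] at h5
      obtain ⟨c1, c2, c3⟩ :=
        snoc_chain (w := w) (x := fun i : Fin (N + 1) => v i.castSucc) hu hum hus hgt (hzm _) h5
      have := last_sign_pos hN hz hzm hzs c1 c2 c3
      rw [Fin.snoc_last] at this
      rw [mul_comm] at hzlast
      exact absurd hzlast (not_lt.2 this.le)

/-- **Breakpoint lemma.**  If `w` has chain bound `N + 1` on `S ⊆ (1, ∞)` and some chain of length
`N + 1` exists, then for `c := log A`, `A` the infimum of the last points of such chains, `c > 0`
and `t ↦ w(t) (log t − c)` has chain bound `N` on `S` — the step `φ*(λ) = (λ₀ − λ) φ(λ)`,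
`R* = R − 1` of Laguerre's proof, for a general weight (no piecewise constancy; hence the infimum).
[cite: PolyaSzego1976, Part V, Chap. 1, Problem 80 (solution, p. 231: the reduction step R* = R − 1)] -/
theorem chainBound_mul_log_sub {w : ℝ → ℝ} {S : Set ℝ} (hS : S ⊆ Ioi 1) {N : ℕ}
    (hN : ∀ (n : ℕ) (x : Fin (n + 1) → ℝ), StrictMono x → (∀ i, x i ∈ S) →
      (∀ i : Fin n, w (x i.castSucc) * w (x i.succ) < 0) → n ≤ N + 1)
    {z : Fin (N + 2) → ℝ} (hz : StrictMono z) (hzm : ∀ i, z i ∈ S)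
    (hzs : ∀ i : Fin (N + 1), w (z i.castSucc) * w (z i.succ) < 0) :
    ∃ c : ℝ, 0 < c ∧ ∀ (n : ℕ) (x : Fin (n + 1) → ℝ), StrictMono x → (∀ i, x i ∈ S) →
      (∀ i : Fin n, (w (x i.castSucc) * (Real.log (x i.castSucc) - c)) *
        (w (x i.succ) * (Real.log (x i.succ) - c)) < 0) → n ≤ N := by
  classical
  -- the set of last points of chains of length `N + 1`, and its infimum `A`
  obtain ⟨T, hT⟩ : ∃ T : Set ℝ, T = {r | ∃ x : Fin (N + 2) → ℝ, StrictMono x ∧ (∀ i, x i ∈ S) ∧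
      (∀ i : Fin (N + 1), w (x i.castSucc) * w (x i.succ) < 0) ∧ x (Fin.last (N + 1)) = r} :=
    ⟨_, rfl⟩
  have hTne : T.Nonempty := ⟨z (Fin.last (N + 1)), by rw [hT]; exact ⟨z, hz, hzm, hzs, rfl⟩⟩
  have hTbdd : BddBelow T := by
    refine ⟨1, ?_⟩
    intro r hr
    rw [hT] at hr
    obtain ⟨x, -, hxm, -, rfl⟩ := hr
    exact le_of_lt (hS (hxm _))
  have hAle : ∀ x : Fin (N + 2) → ℝ, StrictMono x → (∀ i, x i ∈ S) →
      (∀ i : Fin (N + 1), w (x i.castSucc) * w (x i.succ) < 0) →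
      sInf T ≤ x (Fin.last (N + 1)) :=
    fun x hx hxm hxs => csInf_le hTbdd (by rw [hT]; exact ⟨x, hx, hxm, hxs, rfl⟩)
  have hzA : z (Fin.last N).castSucc ≤ sInf T := by
    refine le_csInf hTne ?_
    intro r hr
    rw [hT] at hr
    obtain ⟨x, hx, hxm, hxs, rfl⟩ := hr
    exact (penult_lt_last hN hz hzm hzs hx hxm hxs).le
  have hA1 : 1 < sInf T := lt_of_lt_of_le (hS (hzm _)) hzA
  have hA0 : 0 < sInf T := lt_trans one_pos hA1
  have hfrozen : ∀ t ∈ S, sInf T < t → 0 ≤ w (z (Fin.last (N + 1))) * w t := by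
    intro t ht hAt
    obtain ⟨r, hr, hlt⟩ := exists_lt_of_csInf_lt hTne hAt
    rw [hT] at hr
    obtain ⟨x, hx, hxm, hxs, rfl⟩ := hr
    have hsame := last_sign_pos hN hz hzm hzs hx hxm hxs
    by_contra hneg
    push Not at hneg
    rw [mul_comm] at hsame
    have h' : w (x (Fin.last (N + 1))) * w t < 0 := sgn_pos_neg hsame hneg
    obtain ⟨c1, c2, c3⟩ := snoc_chain hx hxm hxs hlt ht h'
    have := hN (N + 2) _ c1 c2 c3
    omega
  refine ⟨Real.log (sInf T), Real.log_pos hA1, fun n x hx hxm hxs => ?_⟩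
  by_contra hlt
  push Not at hlt
  obtain ⟨p1, p2, p3⟩ :=
    prefix_chain (w := fun t => w t * (Real.log t - Real.log (sInf T))) (show N + 1 ≤ n by omega)
      hx hxm hxs
  exact breakpoint_noChain hS hN hz hzm hzs hA0 hAle hfrozen p1 p2 p3

/-- If `w` has no alternating chain of length `N + 1` in `S`, then every alternating chain of `w` in
`S` has length `≤ N` (an initial segment of a longer chain would have length `N + 1`); i.e. "at most
`N` reversals of sign" is inherited from the absence of `N + 1` of them.
[cite: PolyaSzego1976, Part V, Chap. 1, §2 (reversals of sign of a function), p. 45] -/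
theorem chainBound_of_not_exists {w : ℝ → ℝ} {S : Set ℝ} {N : ℕ}
    (hno : ¬ ∃ z : Fin (N + 2) → ℝ, StrictMono z ∧ (∀ i, z i ∈ S) ∧
      ∀ i : Fin (N + 1), w (z i.castSucc) * w (z i.succ) < 0)
    (n : ℕ) (x : Fin (n + 1) → ℝ) (hx : StrictMono x) (hxm : ∀ i, x i ∈ S)
    (hxs : ∀ i : Fin n, w (x i.castSucc) * w (x i.succ) < 0) : n ≤ N := by
  by_contra hlt
  push Not at hlt
  exact hno ⟨_, prefix_chain (show N + 1 ≤ n by omega) hx hxm hxs⟩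

end Laguerre

end PolyaSignChanges

end Literature.NumberTheory.LFunctions

end
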